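import Summits.ABC.StewartYu.PadicW80Par3D
import HarnessLib

/-!
# The `q = 3` (`p = 2`) parameter record — the NUMERICAL inequalities of the inner steps and of the third step

Support file (theorems only; no named facts), cell `abc-stewartyu` (p1; crux `W80Two` stmt-ABC-19486; design memo
HOME/p1/S2-q3-record-design.md).  Base-`3`, `p = 2` twin of `PadicW80NumericL{,B}` at the instantiation
`ℓ = 1` (`log 2 < 1`; the floors are `V, W ≥ 1`): for every level `J < J₀` and step `k ≤ d` (`k < d`: the
inner steps; `k = d`: the third step) the two branches of the `2`-adic Schwarz–Liouville inequality in
logarithmic form, with the conditioning exponent ABSTRACT — a natural number `cE` with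
`cE·log 2 ≤ kpts·t·log 2 + t·log(2·3^{k+J}S₀)` (the shape p2-g3's `condExp₃` for the nodes `{s : 3 ∤ s}` at
`p = 2` satisfies, as `condSum_mul_log_le` does at odd `p`) — and the threshold budget `B ≤ 𝔘/16 + 3ᵏ𝔘/2`
(covers `logDM3_le_budget` for `k < d` and `bthird_le_budget3` for `k = d`):
(1) `(hL_b + (t−1) + cE)·log 2 + B < U = 3^{d+1}𝔘`;  (2) `hL_b·log 2 + B < kpts·t·log 2`
(gain `log 2` per zero: outer radius `2`, nodes of norm `≤ 1`; `kpts·t ≥ (31/32)(8/3)·3ᵏ𝔘` by `KT3_ge`).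
Everything is [folklore] arithmetic on [cite: Waldschmidt1980, Lemma 3.6–3.7 (pp. 272–273)] and [cite: Yu1989, §3].
-/

noncomputable section

open Finset Real

namespace Summit.ABC.StewartYu

open PadicW80Par (cTp cSp cLp cLp' Ap mRp)

namespace PadicW80ParL

variable {d : ℕ} (P : PadicW80ParL d)

/-! ### The small terms -/

/-- `log 2 ≤ 1` and `0 < log 2`. [folklore] -/
private theorem log_two_bounds : 0 < Real.log 2 ∧ Real.log 2 ≤ 1 :=
  ⟨Real.log_pos one_lt_two, by linarith [Real.log_two_lt_d9]⟩

/-- `h L_b · log 2 ≤ 𝔘/2¹³` at `ℓ = 1`. [folklore] -/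
theorem hLb3_log_two_le (hℓ1 : P.ℓ = 1) : ((P.hparℓ * P.Lb3 : ℕ) : ℝ) * Real.log 2 ≤ P.𝔘3 / 2 ^ 13 := by
  have h := P.hparLb3ℓ_le'
  rw [hℓ1, mul_one] at h
  have h0 : (0 : ℝ) ≤ (P.hparℓ : ℝ) * P.Lb3 := by positivity
  push_cast
  nlinarith [log_two_bounds.1, log_two_bounds.2]

/-- `t_J · log 2 ≤ 𝔘/c_T`. [folklore] -/
theorem tJ3_log_two_le (J : ℕ) : (P.tJ3 J : ℝ) * Real.log 2 ≤ P.𝔘3 / cTp := by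
  have h1 : (P.tJ3 J : ℝ) ≤ P.T3 := by exact_mod_cast P.tJ3_le_T3 J
  have h2 := P.T3_le_𝔘3
  have ht : (0 : ℝ) ≤ P.tJ3 J := Nat.cast_nonneg _
  nlinarith [log_two_bounds.1, log_two_bounds.2]

/-- The range of the points is `≤ U`: `2·3^{k+J}·S₀ ≤ U` for `k ≤ d + 1`, `J < J₀`
(`3ᴶ ≤ L_θ`, `L_θ S₀ ≤ 𝔘/2¹⁴`, `2·3^{d+1}·𝔘/2¹⁴ ≤ 3^{d+1}𝔘 = U`). [folklore] -/
theorem range_le_U {J k : ℕ} (hJ : J < P.J₀3) (hk : k ≤ d + 1) : (2 : ℝ) * (3 ^ (k + J) * P.S₀3) ≤ P.Uℓ := by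
  have hL : (3 : ℝ) ^ J ≤ P.Lθ3 := by exact_mod_cast P.three_pow_le_Lθ3 hJ
  have hLS := P.Lθ3S₀3_le
  have hU := P.𝔘3_pos; have hS := P.S₀3_pos
  have h3k : (3 : ℝ) ^ k ≤ 3 ^ (d + 1) := pow_le_pow_right₀ (by norm_num) hk
  rw [P.U_eq3, pow_add]
  calc (2 : ℝ) * (3 ^ k * 3 ^ J * P.S₀3) = 2 * 3 ^ k * (3 ^ J * P.S₀3) := by ring
    _ ≤ 2 * 3 ^ (d + 1) * (P.Lθ3 * P.S₀3) := by gcongr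
    _ ≤ 2 * 3 ^ (d + 1) * (P.𝔘3 / 2 ^ 14) := by gcongr
    _ ≤ 3 ^ (d + 1) * P.𝔘3 := by
        have : (0 : ℝ) ≤ 3 ^ (d + 1) * P.𝔘3 := by positivity
        nlinarith

/-- `t_J · log(2·3^{k+J}·S₀) ≤ 10𝔘/c_T` for `k ≤ d + 1`, `J < J₀` (`log U ≤ 10 W⋆`, `T W⋆ ≤ 𝔘/c_T`). [folklore] -/
theorem tJ3_log_range_le {J k : ℕ} (hJ : J < P.J₀3) (hk : k ≤ d + 1) :
    (P.tJ3 J : ℝ) * Real.log (2 * (3 ^ (k + J) * P.S₀3)) ≤ 10 * (P.𝔘3 / cTp) := by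
  have hr := P.range_le_U hJ hk
  have hS := P.S₀3_pos
  have hpos : (0 : ℝ) < 2 * (3 ^ (k + J) * P.S₀3) := by positivity
  have hlog : Real.log (2 * (3 ^ (k + J) * P.S₀3)) ≤ 10 * P.Wstarℓ :=
    (Real.log_le_log hpos hr).trans P.log_U_le
  have hlog0 : 0 ≤ Real.log (2 * (3 ^ (k + J) * P.S₀3)) := by
    apply Real.log_nonneg
    have h1 : (1 : ℝ) ≤ 3 ^ (k + J) := one_le_pow₀ (by norm_num)
    have h6 : (6 : ℝ) ≤ P.S₀3 := by exact_mod_cast P.six_le_S₀3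
    nlinarith
  have h1 : (P.tJ3 J : ℝ) ≤ P.T3 := by exact_mod_cast P.tJ3_le_T3 J
  have hTW := P.T3Wstar_le
  have ht : (0 : ℝ) ≤ P.tJ3 J := Nat.cast_nonneg _
  calc (P.tJ3 J : ℝ) * Real.log (2 * (3 ^ (k + J) * P.S₀3)) ≤ P.T3 * (10 * P.Wstarℓ) :=
        mul_le_mul h1 hlog hlog0 (Nat.cast_nonneg _)
    _ = 10 * (P.T3 * P.Wstarℓ) := by ring
    _ ≤ 10 * (P.𝔘3 / cTp) := by gcongr

/-! ### The two branches -/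

/-- **Gain branch (2)** at step `k` of level `J < J₀` (`k ≤ d`; `k = d` is the third step), `ℓ = 1`: for any
threshold budget `B ≤ 𝔘/16 + 3ᵏ𝔘/2`, `hL_b·log 2 + B < kpts·t_J·log 2`.
[cite: Waldschmidt1980, Lemma 3.6–3.7 (pp. 272–273)] [cite: Yu1989, §3 Lemma 3.3] -/
theorem step3_ineq_two (hℓ1 : P.ℓ = 1) {J : ℕ} (hJ : J < P.J₀3) (k : ℕ) {B : ℝ}
    (hB : B ≤ P.𝔘3 / 16 + 3 ^ k * P.𝔘3 / 2) :
    ((P.hparℓ * P.Lb3 : ℕ) : ℝ) * Real.log 2 + B < (P.kpts3 J k : ℝ) * (P.tJ3 J : ℝ) * Real.log 2 := by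
  have hKT := P.KT3_ge hJ k
  rw [hℓ1, div_one] at hKT
  have hh := P.hLb3_log_two_le hℓ1
  have hU := P.𝔘3_pos
  have h3k : (1 : ℝ) ≤ 3 ^ k := one_le_pow₀ (by norm_num)
  obtain ⟨hl0, hl1⟩ := log_two_bounds
  have hl2 : (0.6931471803 : ℝ) < Real.log 2 := Real.log_two_gt_d9
  have hkt0 : (0 : ℝ) ≤ (P.kpts3 J k : ℝ) * (P.tJ3 J : ℝ) := by positivity
  -- `kpts·t·log 2 ≥ (31/32)(8/3)·0.693·3ᵏ𝔘 > 1.78·3ᵏ𝔘 ≥ 𝔘/2¹³ + 𝔘/16 + 3ᵏ𝔘/2`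
  have h1 : 31 / 32 * (8 / 3 * 3 ^ k * P.𝔘3) * 0.6931471803 ≤ (P.kpts3 J k : ℝ) * (P.tJ3 J : ℝ) * Real.log 2 := by
    have h0 : (0 : ℝ) ≤ 31 / 32 * (8 / 3 * 3 ^ k * P.𝔘3) := by positivity
    exact mul_le_mul hKT hl2.le (by norm_num) hkt0
  have h3kU : P.𝔘3 ≤ 3 ^ k * P.𝔘3 := by nlinarith
  nlinarith

/-- **Smallness branch (1)** at step `k ≤ d` of level `J < J₀`, `ℓ = 1`: for any conditioning exponent `cE`
with `cE·log 2 ≤ kpts·t_J·log 2 + t_J·log(2·3^{k+J}S₀)` and any threshold budget `B ≤ 𝔘/16 + 3ᵏ𝔘/2`,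
`(hL_b + (t_J − 1) + cE)·log 2 + B < U`. [cite: Waldschmidt1980, Lemma 3.6–3.7 (pp. 272–273)] [cite: Yu1989, §3] -/
theorem step3_ineq_one (hℓ1 : P.ℓ = 1) {J : ℕ} (hJ : J < P.J₀3) {k : ℕ} (hk : k ≤ d) {cE : ℕ}
    (hcE : (cE : ℝ) * Real.log 2 ≤
      (P.kpts3 J k : ℝ) * (P.tJ3 J : ℝ) * Real.log 2 + (P.tJ3 J : ℝ) * Real.log (2 * (3 ^ (k + J) * P.S₀3)))
    {B : ℝ} (hB : B ≤ P.𝔘3 / 16 + 3 ^ k * P.𝔘3 / 2) :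
    ((P.hparℓ * P.Lb3 + (P.tJ3 J - 1) + cE : ℕ) : ℝ) * Real.log 2 + B < P.Uℓ := by
  have hKT := P.KT3_le J k
  rw [hℓ1, div_one] at hKT
  have hh := P.hLb3_log_two_le hℓ1
  have ht := P.tJ3_log_two_le J
  have hr := P.tJ3_log_range_le hJ (show k ≤ d + 1 by omega)
  have hU := P.𝔘3_pos
  obtain ⟨hl0, hl1⟩ := log_two_bounds
  have h3k : (3 : ℝ) ^ k ≤ 3 ^ d := pow_le_pow_right₀ (by norm_num) hk
  have h3d0 : (0 : ℝ) ≤ 3 ^ d := by positivity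
  -- `(t − 1)·log 2 ≤ t·log 2`
  have ht1 : (((P.tJ3 J - 1 : ℕ)) : ℝ) * Real.log 2 ≤ (P.tJ3 J : ℝ) * Real.log 2 := by
    have : (((P.tJ3 J - 1 : ℕ)) : ℝ) ≤ P.tJ3 J := by exact_mod_cast Nat.sub_le _ _
    exact mul_le_mul_of_nonneg_right this hl0.le
  -- `kpts·t·log 2 ≤ (8/3)·3ᵏ𝔘·log 2 ≤ 1.85·3ᵏ𝔘`
  have hl2 : Real.log 2 < 0.6931471808 := Real.log_two_lt_d9
  have hmain : (P.kpts3 J k : ℝ) * (P.tJ3 J : ℝ) * Real.log 2 ≤ 8 / 3 * 3 ^ k * P.𝔘3 * 0.6931471808 := by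
    have hkt0 : (0 : ℝ) ≤ (P.kpts3 J k : ℝ) * (P.tJ3 J : ℝ) := by positivity
    exact mul_le_mul hKT hl2.le hl0.le (by positivity)
  have h3kU : (3 : ℝ) ^ k * P.𝔘3 ≤ 3 ^ d * P.𝔘3 := mul_le_mul_of_nonneg_right h3k hU.le
  have h1d : P.𝔘3 ≤ 3 ^ d * P.𝔘3 := by
    have : (1 : ℝ) ≤ 3 ^ d := one_le_pow₀ (by norm_num)
    nlinarith
  have esplit : ((P.hparℓ * P.Lb3 + (P.tJ3 J - 1) + cE : ℕ) : ℝ) * Real.log 2 =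
      ((P.hparℓ * P.Lb3 : ℕ) : ℝ) * Real.log 2 + (((P.tJ3 J - 1 : ℕ)) : ℝ) * Real.log 2 + (cE : ℝ) * Real.log 2 := by
    push_cast; ring
  rw [esplit, P.U_eq3, pow_succ]
  unfold cTp at ht hr
  -- total `≤ 𝔘/2¹³ + 𝔘/c_T + 1.85·3ᵏ𝔘 + 10𝔘/c_T + 𝔘/16 + 3ᵏ𝔘/2 < 3·3ᵈ𝔘`
  linarith

end PadicW80ParL

end Summit.ABC.StewartYu

end
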